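import Summits.Ventures.PercRepro.RankLevelSetHallLostHall

/-!
# PercRepro — THE DEFECT TRANSPORT (TR): THE UP-HALL FORM AT THE TIGHT LAYER FROM A FRACTIONAL TRANSPORT OF THE LYM
DEFECTS OF THE MEMBERS ONTO THE BIG `Y`-SETS (p4, gen 36; C-044, UP form; paper proofs/P4-CELL-THREE.md §14.22 (r)–(s))

The lost-set injection `LostInj M p q` (§14.20) routes every LOST set `S` to its own big `Y`-set `φ S`, which then pays
`1/C(#S, q)` to each member inside `S`.  Only the *totals* matter for the UP-Hall form: a member `Z` must recover its LYM
defect `δ(Z) = lymDefect M p q Z` (`ruleLMid_eq`: the middle levels pay `Φ(p,q) − δ(Z)`), and a big `Y`-set may pay at most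
one unit in all.  **(TR)** `BigTransport M p q` is exactly this transport problem — weights `v Z T ≥ 0` supported on
`Z ⊆ T ∈ bigY`, receipts `≥ δ(Z)`, loads `≤ 1` — with no lost sets in sight; `BigTransportP` is its restriction to the
`p`-sets.  Both are `Prop`s, NOT asserted.  (INJ) ⟹ (TR) (`bigTransport_of_lostInj`), (TR_p) ⟹ (TR)
(`bigTransport_of_bigTransportP`), and **(TR) ⟹ the UP-Hall form** (`hallUp_of_ncard_eq_of_bigTransport`) through night-1's
`hallUp_of_fracMatching`.  The converse (TR) ⟹ (INJ) is FALSE: on `M = B₄ ⊕ B₅ ⊕ U_{1,2}` (two triangular books and a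
parallel pair, 22 elements, cell `(12, 10)`) (INJ) with `p`-set targets fails (31,232 / 31,488) while (TR_p) holds with
four-fold slack (paper §14.22 (r)–(s), exact max-flow); the per-cyclic-set reduction (INJ-max) of §14.22 (j)/(l)/(p)
fails there too.  So (TR) is the weakest sufficient condition of this kind in the kernel, and the one to prove.
* `BigTransport`, `BigTransportP` (over `bigY_finite` of RankLevelSetHallLostHall); `transportWeight` — Rule L's LYM split on the middle levels, `v` on the
  big sets; `transportWeight_nonneg`, `subset_of_transportWeight_ne_zero`, `transportWeight_load_le_one`,
  `phiK_le_transportWeight_recv`;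
* `bigTransport_of_bigTransportP`, `bigTransport_of_lostInj`;
* **`hallUp_of_ncard_eq_of_bigTransport`** — `#E = p + q`, `q < p`, `BigTransport M p q` ⇒ `Φ(p,q)·#𝒜 ≤ #upNbhd(𝒜)`.
Axioms: standard.
-/

namespace PercRepro

open Set Matroid Finset

variable {α : Type} (M : Matroid α) [M.Finite]

/-- **(TR)** — a `Prop`, NOT asserted: a transport `v` of the LYM defects of the members onto the big `Y`-sets — weights
`v Z T ≥ 0` supported on the pairs `Z ⊆ T` with `T` big, every member receiving at least its defect `δ(Z)`, every big
`Y`-set paying at most `1`. -/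
def BigTransport (p q : ℕ) : Prop :=
  ∃ v : Set α → Set α → ℚ, (∀ Z T, 0 ≤ v Z T) ∧ (∀ Z T, v Z T ≠ 0 → Z ⊆ T ∧ T ∈ bigY M p q) ∧
    (∀ Z ∈ cellMembers M p q, lymDefect M p q Z ≤ ∑ T ∈ (bigY_finite M p q).toFinset, v Z T) ∧
    (∀ T ∈ bigY M p q, ∑ Z ∈ (cellMembers_finite M p q).toFinset, v Z T ≤ 1)

/-- **(TR_p)** — a `Prop`, NOT asserted: the transport of `BigTransport` supported on the `p`-sets only. -/
def BigTransportP (p q : ℕ) : Prop :=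
  ∃ v : Set α → Set α → ℚ, (∀ Z T, 0 ≤ v Z T) ∧ (∀ Z T, v Z T ≠ 0 → Z ⊆ T ∧ T ∈ bigY M p q ∧ T.ncard = p) ∧
    (∀ Z ∈ cellMembers M p q, lymDefect M p q Z ≤ ∑ T ∈ (bigY_finite M p q).toFinset, v Z T) ∧
    (∀ T ∈ bigY M p q, ∑ Z ∈ (cellMembers_finite M p q).toFinset, v Z T ≤ 1)

/-- (TR_p) ⟹ (TR): a `p`-set is a big set. -/
theorem bigTransport_of_bigTransportP (p q : ℕ) (h : BigTransportP M p q) : BigTransport M p q := by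
  obtain ⟨v, hnn, hsupp, hdem, hcap⟩ := h
  exact ⟨v, hnn, fun Z T hv => ⟨(hsupp Z T hv).1, (hsupp Z T hv).2.1⟩, hdem, hcap⟩

/-- **The weight of the transport**: Rule L's LYM split on the middle levels (`#T < p`), the transport `v` on the big sets. -/
noncomputable def transportWeight (p q : ℕ) (v : Set α → Set α → ℚ) (Z T : Set α) : ℚ := by
  classical
  exact if T.ncard < p then ruleLWeight M p q Z T else v Z T

omit [M.Finite] in
/-- The weights are non-negative. -/
theorem transportWeight_nonneg (p q : ℕ) (v : Set α → Set α → ℚ) (hnn : ∀ Z T, 0 ≤ v Z T) (Z T : Set α) :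
    0 ≤ transportWeight M p q v Z T := by
  classical
  unfold transportWeight
  split_ifs with h
  · exact ruleLWeight_nonneg M p q Z T
  · exact hnn Z T

omit [M.Finite] in
/-- The weights are supported on the pairs `Z ⊆ T`. -/
theorem subset_of_transportWeight_ne_zero (p q : ℕ) (v : Set α → Set α → ℚ)
    (hsupp : ∀ Z T, v Z T ≠ 0 → Z ⊆ T ∧ T ∈ bigY M p q) (Z T : Set α)
    (h : transportWeight M p q v Z T ≠ 0) : Z ⊆ T := by
  classical
  unfold transportWeight at h
  split_ifs at h with hT
  · exact subset_of_ruleLWeight_ne_zero M p q Z T h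
  · exact (hsupp Z T h).1

/-- **Every `Y`-set is loaded at most `1`** (tight layer): the middle levels by night-1's `ruleLWeight_load_le_one`, the big
sets by the capacity of the transport. -/
theorem transportWeight_load_le_one (p q : ℕ) (hE : M.E.ncard = p + q) (v : Set α → Set α → ℚ)
    (hcap : ∀ T ∈ bigY M p q, ∑ Z ∈ (cellMembers_finite M p q).toFinset, v Z T ≤ 1) (T : Set α)
    (hT : T ∈ cellY M p q) :
    ∑ Z ∈ (cellMembers_finite M p q).toFinset, transportWeight M p q v Z T ≤ 1 := by
  classical
  unfold transportWeight
  by_cases hsmall : T.ncard < p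
  · simp only [if_pos hsmall]
    exact ruleLWeight_load_le_one M hE T hT
  · simp only [if_neg hsmall]
    exact hcap T ⟨hT, not_lt.1 hsmall⟩

/-- **Every member receives at least `Φ(p,q)`** (tight layer): `Φ − δ(Z)` from the middle levels (`ruleLMid_eq`) and
at least `δ(Z)` from the big sets (the demand of the transport). -/
theorem phiK_le_transportWeight_recv (p q : ℕ) (hE : M.E.ncard = p + q) (hpq : q < p) (v : Set α → Set α → ℚ)
    (hdem : ∀ Z ∈ cellMembers M p q, lymDefect M p q Z ≤ ∑ T ∈ (bigY_finite M p q).toFinset, v Z T)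
    {Z : Set α} (hZ : Z ∈ cellMembers M p q) :
    phiK p q ≤ ∑ T ∈ (cellY_finite M p q).toFinset, transportWeight M p q v Z T := by
  classical
  set Yf : Finset (Set α) := (cellY_finite M p q).toFinset with hYf
  set Bf : Finset (Set α) := (bigY_finite M p q).toFinset with hBf
  have hmemY : ∀ T, T ∈ Yf ↔ T ∈ cellY M p q := fun T => by
    rw [hYf, (cellY_finite M p q).mem_toFinset]
  have hmemB : ∀ T, T ∈ Bf ↔ T ∈ bigY M p q := fun T => by
    rw [hBf, (bigY_finite M p q).mem_toFinset]
  -- the weight on a `Y`-set splits into the middle-level part and the big-set part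
  have hsplit : ∀ T ∈ Yf, transportWeight M p q v Z T
      = (if Z ⊆ T ∧ T.ncard < p then 1 / ((T.ncard.choose q : ℕ) : ℚ) else 0)
        + (if T.ncard < p then 0 else v Z T) := by
    intro T hTY
    rw [hmemY] at hTY
    unfold transportWeight
    by_cases hsmall : T.ncard < p
    · rw [if_pos hsmall, if_pos hsmall, add_zero]
      unfold ruleLWeight
      by_cases hZT : Z ⊆ T
      · rw [if_pos ⟨hZ, hZT, hTY⟩, if_pos hsmall, if_pos ⟨hZT, hsmall⟩]
      · rw [if_neg (fun hc => hZT hc.2.1), if_neg (fun hc => hZT hc.1)]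
    · rw [if_neg hsmall, if_neg hsmall, if_neg (fun hc => hsmall hc.2), zero_add]
  rw [Finset.sum_congr rfl hsplit, Finset.sum_add_distrib]
  -- the middle levels
  have hmid : ∑ T ∈ Yf, (if Z ⊆ T ∧ T.ncard < p then 1 / ((T.ncard.choose q : ℕ) : ℚ) else 0)
      = ruleLMid M p q Z := by
    unfold ruleLMid
    rfl
  -- the big sets: the `Y`-sets with `#T ≥ p` are exactly the big `Y`-sets
  have hfilter : Yf.filter (fun T => ¬ T.ncard < p) = Bf := by
    ext T
    rw [Finset.mem_filter, hmemY, hmemB, not_lt]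
    rfl
  have hbig : ∑ T ∈ Yf, (if T.ncard < p then 0 else v Z T) = ∑ T ∈ Bf, v Z T := by
    rw [← hfilter, Finset.sum_filter]
    refine Finset.sum_congr rfl (fun T _ => ?_)
    by_cases hsmall : T.ncard < p
    · rw [if_pos hsmall, if_neg (fun hc => hc hsmall)]
    · rw [if_neg hsmall, if_pos hsmall]
  rw [hmid, hbig, ruleLMid_eq M p q hE hpq hZ]
  have := hdem Z hZ
  linarith

/-- **THE TRANSFER**: at the tight layer `#E = p + q` with `q < p`, a transport of the LYM defects onto the big `Y`-sets
(`BigTransport M p q`) gives the UP-Hall condition for every family of members. -/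
theorem hallUp_of_ncard_eq_of_bigTransport (p q : ℕ) (hE : M.E.ncard = p + q) (hpq : q < p)
    (h : BigTransport M p q) (𝒜 : Set (Set α)) (h𝒜 : 𝒜 ⊆ cellMembers M p q) :
    phiK p q * (𝒜.ncard : ℚ) ≤ ((upNbhd M p q 𝒜).ncard : ℚ) := by
  obtain ⟨v, hnn, hsupp, hdem, hcap⟩ := h
  exact hallUp_of_fracMatching M p q (transportWeight M p q v) (transportWeight_nonneg M p q v hnn)
    (subset_of_transportWeight_ne_zero M p q v hsupp)
    (fun Z hZ => phiK_le_transportWeight_recv M p q hE hpq v hdem hZ)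
    (transportWeight_load_le_one M p q hE v hcap) 𝒜 h𝒜

/-- **(INJ) ⟹ (TR)** (tight layer): the big part of the weight of the lost-set injection is a transport — every lost set
`S` pays `1/C(#S, q)` to each member inside it at `φ S`; a member recovers exactly its defect
(`sum_lost_through_eq_lymDefect`), a big set is the image of at most one lost set and pays at most `1`. -/
theorem bigTransport_of_lostInj (p q : ℕ) (hE : M.E.ncard = p + q) (hpq : q < p) (h : LostInj M p q) :
    BigTransport M p q := by
  classical
  obtain ⟨φ, hφ, hinj⟩ := h
  set Lf : Finset (Set α) := (lostSets_finite M p q).toFinset with hLf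
  set Mf : Finset (Set α) := (cellMembers_finite M p q).toFinset with hMf
  set Bf : Finset (Set α) := (bigY_finite M p q).toFinset with hBf
  have hmemL : ∀ S, S ∈ Lf ↔ S ∈ lostSets M p q := fun S => by
    rw [hLf, (lostSets_finite M p q).mem_toFinset]
  have hmemM : ∀ Z, Z ∈ Mf ↔ Z ∈ cellMembers M p q := fun Z => by
    rw [hMf, (cellMembers_finite M p q).mem_toFinset]
  have hmemB : ∀ T, T ∈ Bf ↔ T ∈ bigY M p q := fun T => by
    rw [hBf, (bigY_finite M p q).mem_toFinset]
  refine ⟨fun Z T => if T ∈ bigY M p q then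
      ∑ S ∈ Lf, (if Z ⊆ S ∧ φ S = T then 1 / ((S.ncard.choose q : ℕ) : ℚ) else 0) else 0, ?_, ?_, ?_, ?_⟩
  · -- non-negative
    intro Z T
    dsimp only
    split_ifs
    · exact Finset.sum_nonneg (fun S _ => by split_ifs <;> positivity)
    · exact le_rfl
  · -- support
    intro Z T hv
    dsimp only at hv
    split_ifs at hv with hTB
    · obtain ⟨S, hS, hne⟩ := Finset.exists_ne_zero_of_sum_ne_zero hv
      rw [hmemL] at hS
      by_cases hc : Z ⊆ S ∧ φ S = T
      · exact ⟨hc.2 ▸ hc.1.trans (hφ S hS).2, hTB⟩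
      · rw [if_neg hc] at hne
        exact absurd rfl hne
    · exact absurd rfl hv
  · -- demand: every member recovers its defect
    intro Z hZ
    dsimp only
    have hpt : ∀ T ∈ Bf, (if T ∈ bigY M p q then
        ∑ S ∈ Lf, (if Z ⊆ S ∧ φ S = T then 1 / ((S.ncard.choose q : ℕ) : ℚ) else 0) else 0)
        = ∑ S ∈ Lf, (if Z ⊆ S ∧ φ S = T then 1 / ((S.ncard.choose q : ℕ) : ℚ) else 0) := by
      intro T hT
      rw [hmemB] at hT
      rw [if_pos hT]
    rw [Finset.sum_congr rfl hpt, Finset.sum_comm]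
    have hinner : ∀ S ∈ Lf, ∑ T ∈ Bf, (if Z ⊆ S ∧ φ S = T then 1 / ((S.ncard.choose q : ℕ) : ℚ) else 0)
        = if Z ⊆ S then 1 / ((S.ncard.choose q : ℕ) : ℚ) else 0 := by
      intro S hSL
      rw [hmemL] at hSL
      have hφB : φ S ∈ Bf := (hmemB _).2 (hφ S hSL).1
      have hpt' : ∀ T ∈ Bf, (if Z ⊆ S ∧ φ S = T then 1 / ((S.ncard.choose q : ℕ) : ℚ) else 0)
          = if φ S = T then (if Z ⊆ S then 1 / ((S.ncard.choose q : ℕ) : ℚ) else 0) else 0 := by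
        intro T _
        by_cases hT : φ S = T
        · rw [if_pos hT]
          by_cases hZS : Z ⊆ S
          · rw [if_pos ⟨hZS, hT⟩, if_pos hZS]
          · rw [if_neg (fun hc => hZS hc.1), if_neg hZS]
        · rw [if_neg hT, if_neg (fun hc => hT hc.2)]
      rw [Finset.sum_congr rfl hpt', Finset.sum_ite_eq, if_pos hφB]
    rw [Finset.sum_congr rfl hinner, ← Finset.sum_filter]
    exact le_of_eq (sum_lost_through_eq_lymDefect M p q hE hpq hZ).symm
  · -- capacity: a big set is the image of at most one lost set, which pays at most `1`
    intro T hTB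
    dsimp only
    have hpt : ∀ Z ∈ Mf, (if T ∈ bigY M p q then
        ∑ S ∈ Lf, (if Z ⊆ S ∧ φ S = T then 1 / ((S.ncard.choose q : ℕ) : ℚ) else 0) else 0)
        = ∑ S ∈ Lf, (if Z ⊆ S ∧ φ S = T then 1 / ((S.ncard.choose q : ℕ) : ℚ) else 0) := by
      intro Z _
      rw [if_pos hTB]
    rw [Finset.sum_congr rfl hpt, Finset.sum_comm]
    have hS : ∀ S ∈ Lf, (∑ Z ∈ Mf, if Z ⊆ S ∧ φ S = T then 1 / ((S.ncard.choose q : ℕ) : ℚ) else 0)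
        ≤ if φ S = T then 1 else 0 := by
      intro S hSL
      rw [hmemL] at hSL
      by_cases hφS : φ S = T
      · simp only [hφS, and_true, if_true]
        rw [Finset.sum_ite, Finset.sum_const_zero, add_zero, Finset.sum_const, nsmul_eq_mul]
        have hcount : (Mf.filter (fun Z => Z ⊆ S)).card ≤ S.ncard.choose q := by
          have h := ncard_members_subset_le_choose M hE hSL.1
          have heq : {Z : Set α | Z ∈ cellMembers M p q ∧ Z ⊆ S}
              = ((Mf.filter (fun Z => Z ⊆ S) : Finset (Set α)) : Set (Set α)) := by
            ext Z
            rw [Finset.coe_filter, Set.mem_setOf_eq, Set.mem_setOf_eq, hmemM]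
          rw [heq, ncard_coe_finset] at h
          exact h
        have hpos : (0 : ℚ) < ((S.ncard.choose q : ℕ) : ℚ) := by
          exact_mod_cast Nat.choose_pos hSL.2.2.1.le
        rw [mul_one_div, div_le_one hpos]
        exact_mod_cast hcount
      · simp only [hφS, and_false, if_false]
        exact le_of_eq (Finset.sum_const_zero)
    refine (Finset.sum_le_sum hS).trans ?_
    rw [Finset.sum_boole]
    have hcard : (Lf.filter (fun S => φ S = T)).card ≤ 1 := by
      rw [Finset.card_le_one]
      intro S₁ hS₁ S₂ hS₂
      rw [Finset.mem_filter, hmemL] at hS₁ hS₂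
      exact hinj hS₁.1 hS₂.1 (hS₁.2.trans hS₂.2.symm)
    exact_mod_cast hcard

end PercRepro
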